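import Summits.FinalStateConjecture.FinalStateConjecture.Theses.BartnikGapSettling
import Literature.Geometry.Lorentzian.CollarMargin

/-!
# Route BartnikGapSettling — crux `GapExhaustion` (stmt-FinalStateConjecture-10808), negative side:
# the filed text is false on a far-wild black-hole development

`GapExhaustion` is `∀ admissible MGHD 𝒟, IsMaximal → complete 𝓘⁺ → ⟨collar-margin clause⟩ →
∃ N₀ m₀ χ, … ∀ k, ∃ Λ < ∞, ∀ δ γ > 0, ∀ compact K, ∃ ⟨late (Λ,k)-leaf with N ≤ N₀ thick collars
δ-close in Cᵏ to Kerr, a probe point p, a cut Bondi energy of the core {p} ∪ ⋃ collars, and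
Bondi–Bartnik gap ≤ γ⟩`. The collar tolerance of the CONCLUSION is the unweighted `Cᵏ` sup norm at
EVERY order `k` (the consumer picks `k`), while admissibility of the data
(`h = (1 + 2M/ρ)δ + o₂(ρ⁻¹)`, `k = o₁(ρ⁻²)`) controls two derivatives of `h` only. Line lead c1
(`Cruxes/GapExhaustion/MISSTATED-c1.md`, D-F) observed on paper that an admissible one-ended datum
with a trapped region and a far tail which is `C²`-quiet but `C³`-wild (conformal method over the
seed `δ + ρ⁻¹⁴ sin(ρ⁶) w₀`) develops, if its MGHD has complete `𝓘⁺`, into a spacetime every late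
region of which is crossed by high-frequency trains with `∇Rm → ∞` while `Rm → 0`; line lead c2
(`Cruxes/GapExhaustion/ADDENDUM-c2.md`) corrected the witness (the hole must sit OFF the focal centre
of the tail, or there must be two holes, so that the refocused outgoing train and the ingoing train
are both present at all late retarded times and no boosted co-moving chart is `C³`-quiet). On such a
development, at order `3`:

* (W) NO thick collar chart of ANY label is `δ₁`-close in `C³` beyond `J⁻(K₁)` — so the
  collar-margin HYPOTHESIS of the item holds (honestly, vacuously: `collarMargin_of_noQuietCollar`),
  and in the conclusion `N = 0` is forced, the core is the probe point `{p}`;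
* (F) late point cones keep a Bondi-energy floor `μ > 0` (a black hole of final Bondi mass `≥ μ`
  is present: every Hawking-mass limit along a round receding family on `∂J⁺{p}` is `≥ μ`);
* (C) late points have arbitrarily light admissible competitors (a small neighbourhood of `p`
  embeds isometrically and time-orientedly into MGHDs of admissible data of arbitrarily small mass,
  Czimek-type small-data extensions + Christodoulou–Klainerman / Bieri, whose point-cone cut energy
  at the image of `p` is `≤ η`).

(W) ∧ (F) ∧ (C) contradict the conclusion at `k = 3`, `δ = δ₁`, `γ = μ/4`, `K = K₁ ∪ K₂`: this
file proves exactly that, as pure logic over the filed text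
(`gapExhaustion_false_of_noQuietCollar_floor_competitors`, binder form), packages the witness as
the construction hypothesis `FarWildBlackHoleExists` (named `H` of the negative-modulo lane; an
MGHD-level object with Bondi-mass information, not constructible in the tree today), and records
`FarWildBlackHoleExists → ¬ GapExhaustion`.

This is a NEGATIVE LEMMA MODULO `H`, not a refutation, and it does not touch the route's thesis: it
certifies that the truth value of the item AS FILED is decided by far-field regularity bookkeeping
(c1's vacuity certificate `GapExhaustion_of_forall_not_collarMargin` is the dual statement for
far-regular data). The repair is the planner's (label window, `N ≤ 1`/connected core, split KCM,
order capped at `k ≤ 2` or scale-weighted norms; MISSTATED-c1.md §3, ADDENDUM-c2.md).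

Line lead `prover-line-stmt-FinalStateConjecture-10808-c2-0`, 2026-08-16.
-/

noncomputable section

-- D-0017: single-problem summit, `Summit.<S>.<S>.…` by design (cf. lakefile `weak.linter.dupNamespace`).
set_option linter.dupNamespace false

open Set
open scoped Manifold ENNReal ContDiff Topology

namespace Summit.FinalStateConjecture.FinalStateConjecture.Theorems.GapExhaustion.Negative

open Literature.Geometry.Lorentzian
open Summit.FinalStateConjecture.FinalStateConjecture.Theses.BartnikGapSettling (GapExhaustion)

/-- **(W) makes the item's hypothesis true, honestly.** If beyond `J⁻(K₁)` no thick collar chart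
of any label `0 < M₁`, `|a₁| ≤ M₁` is `δ₁`-close in `C³` to boosted Kerr (the far-wild witness
(W) of the module docstring), then the spacetime has a collar margin (`Spacetime.CollarMargin`, by
`Iff.rfl` the third hypothesis of `GapExhaustion`) — with ratio `0`, order `3`, size `δ₁` and
compact set `K₁`: the clause is met because no chart qualifies. [folklore] -/
theorem collarMargin_of_noQuietCollar (𝓢 : Spacetime.{0} 4) (δ₁ : ℝ≥0∞) (K₁ : Set 𝓢.carrier)
    (hδ₁ : 0 < δ₁) (hK₁ : IsCompact K₁)
    (hwild : ∀ (M₁ a₁ : ℝ) (mo₁ : lorentzGroup × E4) (B₁ : ModelBackground)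
      (Φ₁ : B₁.domain → 𝓢.carrier), 0 < M₁ → |a₁| ≤ M₁ →
      B₁ = starBackground mo₁.1 mo₁.2 M₁ a₁
        (fun x => Kerr.radius a₁ (poincareInv mo₁.1 mo₁.2 x)) →
      ContMDiffOn 𝓘(ℝ, E4) (𝓡 4) ∞ Φ₁
        {x | -1 < B₁.time x.1 ∧ B₁.time x.1 < 1 ∧ B₁.radius x.1 < 3 * M₁ + 1} →
      Topology.IsOpenEmbedding
        ({x | -1 < B₁.time x.1 ∧ B₁.time x.1 < 1 ∧ B₁.radius x.1 < 3 * M₁ + 1}.restrict Φ₁) →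
      𝓢.truncDeviationCk B₁ Φ₁ 3 (3 * M₁) 0 ≤ δ₁ →
      Disjoint (Φ₁ '' B₁.truncTimeSlab (3 * M₁) 0)
        (𝓢.metric.causalPast 𝓢.timeOrientation K₁) → False) :
    𝓢.CollarMargin :=
  ⟨0, 3, δ₁, K₁, zero_lt_one, hδ₁, hK₁, fun M₁ a₁ mo₁ B₁ Φ₁ hM₁ ha₁ hB hsm hemb hdev hdisj =>
    (hwild M₁ a₁ mo₁ B₁ Φ₁ hM₁ ha₁ hB hsm hemb hdev hdisj).elim⟩

/-- **`GapExhaustion` is false on a far-wild black-hole development** (binder form; the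
hypotheses are exactly the fields of `FarWildBlackHoleExists`). Given a maximal vacuum Cauchy
development `𝒟` of an admissible datum with complete `𝓘⁺` such that (W) beyond `J⁻(K₁)` no
thick collar chart of any label is `δ₁`-close in `C³` to boosted Kerr, (F) every cut Bondi
energy of the cone of every point outside `J⁻(K₂)` is `≥ μ > 0`, and (C) every point `p` outside
`J⁻(K₂)` has, for every `η > 0`, an admissible competitor — an MGHD `𝒟'` of admissible data, an
open `U ∋ p` and `φ : 𝒟 → 𝒟'` smooth on `U`, an open embedding of `U`, isometric and
future-directed on `U` — with a cut Bondi energy `m' ≤ η` of the cone of `φ(p)`: then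
`GapExhaustion` fails. Proof: feed `𝒟` to the item (its margin hypothesis holds by (W) with
`χ₁ = 0`, `k₁ = 3`); in the conclusion take `k = 3`, `δ = δ₁`, `γ = μ/4`, `K = K₁ ∪ K₂`; a
collar of the answer would be a `C³`-`δ₁`-quiet late chart of label `M ≥ m₀ > 0`,
`|a| ≤ χM ≤ M`, excluded by (W), so `N = 0` and the core is `{p}` with `p ∉ J⁻(K₂)`; the gap
clause against the competitor of (C) at `η = μ/4` yields an own energy `≤ 3μ/4 < μ`, against (F).
[folklore] -/
theorem gapExhaustion_false_of_noQuietCollar_floor_competitors (X : Type) [TopologicalSpace X]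
    [ChartedSpace E3 X] [IsManifold (𝓡 3) ∞ X] [T2Space X] [SecondCountableTopology X]
    [ConnectedSpace X] (D : InitialDataSet (𝓡 3) X) (hD : D ∈ admissibleVacuumData X)
    (𝒟 : VacuumCauchyDevelopment D) (hmax : 𝒟.IsMaximal)
    (hcni : Summit.FinalStateConjecture.HasCompleteNullInfinity 𝒟.toCauchyDevelopment)
    (δ₁ : ℝ≥0∞) (K₁ : Set 𝒟.carrier) (hδ₁ : 0 < δ₁) (hK₁ : IsCompact K₁)
    (hwild : ∀ (M₁ a₁ : ℝ) (mo₁ : lorentzGroup × E4) (B₁ : ModelBackground)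
      (Φ₁ : B₁.domain → 𝒟.carrier), 0 < M₁ → |a₁| ≤ M₁ →
      B₁ = starBackground mo₁.1 mo₁.2 M₁ a₁
        (fun x => Kerr.radius a₁ (poincareInv mo₁.1 mo₁.2 x)) →
      ContMDiffOn 𝓘(ℝ, E4) (𝓡 4) ∞ Φ₁
        {x | -1 < B₁.time x.1 ∧ B₁.time x.1 < 1 ∧ B₁.radius x.1 < 3 * M₁ + 1} →
      Topology.IsOpenEmbedding
        ({x | -1 < B₁.time x.1 ∧ B₁.time x.1 < 1 ∧ B₁.radius x.1 < 3 * M₁ + 1}.restrict Φ₁) →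
      𝒟.toSpacetime.truncDeviationCk B₁ Φ₁ 3 (3 * M₁) 0 ≤ δ₁ →
      Disjoint (Φ₁ '' B₁.truncTimeSlab (3 * M₁) 0)
        (𝒟.metric.causalPast 𝒟.timeOrientation K₁) → False)
    (μ : ℝ) (K₂ : Set 𝒟.carrier) (hμ : 0 < μ) (hK₂ : IsCompact K₂)
    (hfloor : ∀ p : 𝒟.carrier, p ∉ 𝒟.metric.causalPast 𝒟.timeOrientation K₂ →
      ∀ m : ℝ, 𝒟.toCauchyDevelopment.HasCutBondiMass {p} m → μ ≤ m)
    (hsmall : ∀ p : 𝒟.carrier, p ∉ 𝒟.metric.causalPast 𝒟.timeOrientation K₂ →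
      ∀ η : ℝ, 0 < η →
      ∃ (X' : Type) (_ : TopologicalSpace X') (_ : ChartedSpace E3 X')
        (_ : IsManifold (𝓡 3) ∞ X') (_ : T2Space X') (_ : SecondCountableTopology X')
        (_ : ConnectedSpace X') (D' : InitialDataSet (𝓡 3) X') (_ : D' ∈ admissibleVacuumData X')
        (𝒟' : VacuumCauchyDevelopment D') (U : Set 𝒟.carrier) (φ : 𝒟.carrier → 𝒟'.carrier)
        (m' : ℝ),
        𝒟'.IsMaximal ∧ IsOpen U ∧ p ∈ U ∧ ContMDiffOn (𝓡 4) (𝓡 4) ∞ φ U ∧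
        Topology.IsOpenEmbedding (U.restrict φ) ∧
        (∀ q ∈ U, pullbackBilin (I := 𝓡 4) (I' := 𝓡 4) φ 𝒟'.metric.val q = 𝒟.metric.val q) ∧
        (∀ q ∈ U, 𝒟'.timeOrientation.IsFutureDirected
          (mfderiv (𝓡 4) (𝓡 4) φ q (𝒟.timeOrientation.vectorField q))) ∧
        𝒟'.toCauchyDevelopment.HasCutBondiMass (φ '' {p}) m' ∧ m' ≤ η) :
    ¬ GapExhaustion := by
  intro hG
  obtain ⟨N₀, m₀, χ, hm₀, hχ, hall⟩ := hG X D hD 𝒟 hmax hcni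
    ⟨0, 3, δ₁, K₁, zero_lt_one, hδ₁, hK₁, fun M₁ a₁ mo₁ B₁ Φ₁ hM₁ ha₁ hB hsm hemb hdev hdisj =>
      (hwild M₁ a₁ mo₁ B₁ Φ₁ hM₁ ha₁ hB hsm hemb hdev hdisj).elim⟩
  obtain ⟨Λ, -, hall⟩ := hall 3
  have hμ4 : 0 < μ / 4 := by positivity
  obtain ⟨N, M, a, S, p, mo, B, Φ, -, hwin, -, hp, hlate, hB, hΦ, hdev, hS, -, hmass, hgap⟩ :=
    hall δ₁ (μ / 4) hδ₁ hμ4 (K₁ ∪ K₂) (hK₁.union hK₂)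
  have hlate₁ : Disjoint (𝒟.metric.causalFuture 𝒟.timeOrientation S)
      (𝒟.metric.causalPast 𝒟.timeOrientation K₁) :=
    hlate.mono_right (LorentzianMetric.causalFuture_mono subset_union_left)
  have hlate₂ : Disjoint (𝒟.metric.causalFuture 𝒟.timeOrientation S)
      (𝒟.metric.causalPast 𝒟.timeOrientation K₂) :=
    hlate.mono_right (LorentzianMetric.causalFuture_mono subset_union_right)
  rcases Nat.eq_zero_or_pos N with rfl | hNpos
  · -- no collar: the core is the probe point, late w.r.t. `K₂`
    have hpK₂ : p ∉ 𝒟.metric.causalPast 𝒟.timeOrientation K₂ := fun hpK =>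
      Set.disjoint_left.1 hlate₂ (LorentzianMetric.subset_causalFuture _ _ _ hp) hpK
    have hcore : ({p} ∪ ⋃ i : Fin 0, Φ i '' (B i).truncTimeSlab (3 * M i) 0) = {p} := by
      rw [iUnion_of_empty, union_empty]
    rw [hcore] at hgap
    obtain ⟨X', _, _, _, _, _, _, D', hD', 𝒟', U, φ, m', hmax', hU, hpU, hφ, hemb, hiso, hfut,
      hm', hm'η⟩ := hsmall p hpK₂ (μ / 4) hμ4
    obtain ⟨m, hm, hmle⟩ := hgap X' D' hD' 𝒟' U φ m' hmax' hU (singleton_subset_iff.2 hpU) hφ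
      hemb hiso hfut hm' (μ / 4) hμ4
    have hμm : μ ≤ m := hfloor p hpK₂ m hm
    linarith
  · -- a collar: a `C³`-`δ₁`-quiet late thick collar chart, excluded by (W)
    set i : Fin N := ⟨0, hNpos⟩
    have hMi : 0 < M i := hm₀.trans_le (hwin i).1
    have hai : |a i| ≤ M i := (hwin i).2.2.trans (mul_le_of_le_one_left hMi.le hχ.le)
    have hcol : Disjoint (Φ i '' (B i).truncTimeSlab (3 * M i) 0)
        (𝒟.metric.causalPast 𝒟.timeOrientation K₁) :=
      hlate₁.mono_left ((hS i).trans (LorentzianMetric.subset_causalFuture _ _ _))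
    exact hwild (M i) (a i) (mo i) (B i) (Φ i) hMi hai (hB i) (hΦ i).1 (hΦ i).2 (hdev i) hcol

/-- **Construction hypothesis `H` (a far-wild black-hole development).** Some admissible datum has
a maximal vacuum Cauchy development `𝒟` with complete future null infinity together with a size
`0 < δ₁`, compact sets `K₁, K₂ ⊆ 𝒟` and a floor `0 < μ` such that: (W) beyond `J⁻(K₁)` no thick
collar chart of any label `0 < M₁`, `|a₁| ≤ M₁` (boosted Kerr star chart, smooth on and an open
embedding of the collar layer) is `δ₁`-close in the unweighted `C³` sup norm to boosted Kerr on its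
thick collar slab — the development is `C³`-WILD everywhere late; (F) every cut Bondi energy of the
cone `∂J⁺{p}` of every point `p ∉ J⁻(K₂)` is `≥ μ` — a black hole of Bondi mass `≥ μ` persists;
(C) every point `p ∉ J⁻(K₂)` has, for every `η > 0`, an admissible competitor (an MGHD of admissible
data receiving an isometric, future-directed smooth open embedding of an open neighbourhood of `p`)
in which the cone of the image of `p` has a cut Bondi energy `≤ η`. Expected on paper for the MGHD
of a one-ended black-hole datum whose hole sits off the focal centre of a `C²`-quiet, `C³`-wild
admissible far tail (`Cruxes/GapExhaustion/MISSTATED-c1.md` D-F, corrected in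
`Cruxes/GapExhaustion/ADDENDUM-c2.md`): (W) by geometric optics of the in- and (refocused) outgoing
trains, `Rm → 0` but `∇Rm → ∞` in every Lorentz frame; (F) by the area theorem / positivity and
monotonicity of the Bondi mass; (C) by small-data extension of a small ball around `p` (Czimek) and
the stability of Minkowski space (Christodoulou–Klainerman, Bieri). NOT constructible in the tree
today (no MGHD of any admissible datum with a computed far field; no round-section families). -/
def FarWildBlackHoleExists : Prop :=
  ∃ (X : Type) (_ : TopologicalSpace X) (_ : ChartedSpace E3 X) (_ : IsManifold (𝓡 3) ∞ X)
    (_ : T2Space X) (_ : SecondCountableTopology X) (_ : ConnectedSpace X)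
    (D : InitialDataSet (𝓡 3) X) (_ : D ∈ admissibleVacuumData X) (𝒟 : VacuumCauchyDevelopment D)
    (_ : 𝒟.IsMaximal) (_ : Summit.FinalStateConjecture.HasCompleteNullInfinity 𝒟.toCauchyDevelopment)
    (δ₁ : ℝ≥0∞) (K₁ : Set 𝒟.carrier) (μ : ℝ) (K₂ : Set 𝒟.carrier),
    0 < δ₁ ∧ IsCompact K₁ ∧ 0 < μ ∧ IsCompact K₂ ∧
    (∀ (M₁ a₁ : ℝ) (mo₁ : lorentzGroup × E4) (B₁ : ModelBackground)
      (Φ₁ : B₁.domain → 𝒟.carrier), 0 < M₁ → |a₁| ≤ M₁ →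
      B₁ = starBackground mo₁.1 mo₁.2 M₁ a₁
        (fun x => Kerr.radius a₁ (poincareInv mo₁.1 mo₁.2 x)) →
      ContMDiffOn 𝓘(ℝ, E4) (𝓡 4) ∞ Φ₁
        {x | -1 < B₁.time x.1 ∧ B₁.time x.1 < 1 ∧ B₁.radius x.1 < 3 * M₁ + 1} →
      Topology.IsOpenEmbedding
        ({x | -1 < B₁.time x.1 ∧ B₁.time x.1 < 1 ∧ B₁.radius x.1 < 3 * M₁ + 1}.restrict Φ₁) →
      𝒟.toSpacetime.truncDeviationCk B₁ Φ₁ 3 (3 * M₁) 0 ≤ δ₁ →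
      Disjoint (Φ₁ '' B₁.truncTimeSlab (3 * M₁) 0)
        (𝒟.metric.causalPast 𝒟.timeOrientation K₁) → False) ∧
    (∀ p : 𝒟.carrier, p ∉ 𝒟.metric.causalPast 𝒟.timeOrientation K₂ →
      ∀ m : ℝ, 𝒟.toCauchyDevelopment.HasCutBondiMass {p} m → μ ≤ m) ∧
    (∀ p : 𝒟.carrier, p ∉ 𝒟.metric.causalPast 𝒟.timeOrientation K₂ →
      ∀ η : ℝ, 0 < η →
      ∃ (X' : Type) (_ : TopologicalSpace X') (_ : ChartedSpace E3 X')
        (_ : IsManifold (𝓡 3) ∞ X') (_ : T2Space X') (_ : SecondCountableTopology X')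
        (_ : ConnectedSpace X') (D' : InitialDataSet (𝓡 3) X') (_ : D' ∈ admissibleVacuumData X')
        (𝒟' : VacuumCauchyDevelopment D') (U : Set 𝒟.carrier) (φ : 𝒟.carrier → 𝒟'.carrier)
        (m' : ℝ),
        𝒟'.IsMaximal ∧ IsOpen U ∧ p ∈ U ∧ ContMDiffOn (𝓡 4) (𝓡 4) ∞ φ U ∧
        Topology.IsOpenEmbedding (U.restrict φ) ∧
        (∀ q ∈ U, pullbackBilin (I := 𝓡 4) (I' := 𝓡 4) φ 𝒟'.metric.val q = 𝒟.metric.val q) ∧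
        (∀ q ∈ U, 𝒟'.timeOrientation.IsFutureDirected
          (mfderiv (𝓡 4) (𝓡 4) φ q (𝒟.timeOrientation.vectorField q))) ∧
        𝒟'.toCauchyDevelopment.HasCutBondiMass (φ '' {p}) m' ∧ m' ≤ η)

/-- **Negative lemma modulo `FarWildBlackHoleExists`**: one far-wild black-hole development of
one admissible datum falsifies `GapExhaustion` as filed (its conclusion at order `k = 3` needs a
`C³`-quiet late collar or a point core with small Bondi–Bartnik gap; the witness has neither).
[folklore] -/
theorem GapExhaustion_false_of_farWildBlackHoleExists (H : FarWildBlackHoleExists) :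
    ¬ GapExhaustion := by
  obtain ⟨X, _, _, _, _, _, _, D, hD, 𝒟, hmax, hcni, δ₁, K₁, μ, K₂, hδ₁, hK₁, hμ, hK₂, hwild,
    hfloor, hsmall⟩ := H
  exact gapExhaustion_false_of_noQuietCollar_floor_competitors X D hD 𝒟 hmax hcni δ₁ K₁ hδ₁ hK₁
    hwild μ K₂ hμ hK₂ hfloor hsmall

/-- Under `FarWildBlackHoleExists` the witness development also satisfies the item's own
collar-margin hypothesis, so the failure is a failure of the CONCLUSION, not a vacuity of the
hypothesis (contrast `Theorems.GapExhaustion_of_forall_not_collarMargin`). [folklore] -/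
theorem exists_collarMargin_of_farWildBlackHoleExists (H : FarWildBlackHoleExists) :
    ∃ (X : Type) (_ : TopologicalSpace X) (_ : ChartedSpace E3 X) (_ : IsManifold (𝓡 3) ∞ X)
      (_ : T2Space X) (_ : SecondCountableTopology X) (_ : ConnectedSpace X)
      (D : InitialDataSet (𝓡 3) X) (_ : D ∈ admissibleVacuumData X)
      (𝒟 : VacuumCauchyDevelopment D), 𝒟.IsMaximal ∧
        Summit.FinalStateConjecture.HasCompleteNullInfinity 𝒟.toCauchyDevelopment ∧
        𝒟.CollarMargin := by
  obtain ⟨X, _, _, _, _, _, _, D, hD, 𝒟, hmax, hcni, δ₁, K₁, μ, K₂, hδ₁, hK₁, -, -, hwild, -, -⟩ :=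
    H
  exact ⟨X, ‹_›, ‹_›, ‹_›, ‹_›, ‹_›, ‹_›, D, hD, 𝒟, hmax, hcni,
    collarMargin_of_noQuietCollar 𝒟.toSpacetime δ₁ K₁ hδ₁ hK₁ hwild⟩

end Summit.FinalStateConjecture.FinalStateConjecture.Theorems.GapExhaustion.Negative

end
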